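import Summits.ResolutionOfSingularities.ResolutionOfSingularities.Theorems.EquisingularLiftEquisingularLiftNatVertexNotRegular
import Summits.ResolutionOfSingularities.ResolutionOfSingularities.Theorems.EquisingularLiftEquisingularLiftNatSpecimenThreeA2Cubic
import HarnessLib

/-!
# [OURS] SPECIMEN: the `3A₂` cubic surface `x₀x₁x₂ + x₃³ = 0` satisfies the lead's hypothesis #7 `IsoHypPoint` — every characteristic
# (crux `Theses.EquisingularLift.EquisingularLiftNatThree`, stmt-ResolutionOfSingularities-20148)

[OURS · leafhand-res-equisingularlift-10 g0, 2026-08-31; cell `pub/decomp-res`] AI-produced, weaker than expert review; NOT a statement of any manuscript; nothing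
here proves resolution of singularities.  DEF-FREE; no `sorry`; standard axioms; ZERO named hypotheses.

A concrete by-name instance of the bridge ✓ `isoHypPoint_of_singularOneStepVertices` (p829727): seat res-D-pv-013's specimen ✓ `ThreeA2Cubic.elNatAt_threeA2Cubic`
(the cubic surface `x₀x₁x₂ + x₃³` with three `A₂` points at the vertices `P₀, P₁, P₂`, ONE-STEP data ✓ `ThreeA2Cubic.oneStep_data`, charts singular only at
the origin ✓ `chartEqn_singular_only_origin`, chart `x₃ = 1` regular ✓ `isRegularRing_chartRing_three`) is POINT-RESOLVABLE downstairs: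
`IsoHypPoint K 3 V₊(x₀x₁x₂ + x₃³) ι` — so this surface is excluded from the registered isolated residual stub by its hypothesis `¬ IsoHypPoint`, in every
characteristic `p` (including `3`).

* `ThreeA2Cubic.isoHypPoint_threeA2Cubic`.

References: [Hartshorne1977, I Thm. 5.1, I Ex. 5.8]; [BruceWall1979] (the `3A₂` cubic) — through the cited tree files.
-/

set_option linter.dupNamespace false -- mandated namespace `Summit.<Summit>.<Problem>` of this single-conjunct summit

noncomputable section

open CategoryTheory CategoryTheory.Limits AlgebraicGeometry TopologicalSpace
open MvPolynomial HomogeneousLocalization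
open Literature.AlgebraicGeometry.Resolution Literature.AlgebraicGeometry.Motives
open Literature.AlgebraicGeometry.Motives.SmoothHypersurface Literature.AlgebraicGeometry.Motives.ProjectiveSpace
open Summit.ResolutionOfSingularities.ResolutionOfSingularities.Cruxes.EquisingularLift.StrataSplit

namespace Summit.ResolutionOfSingularities.ResolutionOfSingularities.Cruxes.EquisingularLiftNat.Sections

namespace ThreeA2Cubic

/-- **The `3A₂` cubic surface `x₀x₁x₂ + x₃³ = 0` satisfies `IsoHypPoint` over every algebraically closed field**: its three `A₂` vertices are singular
one-step points (multiplicity `2`), the rest is regular; ✓ `isoHypPoint_of_singularOneStepVertices` with `S = [0, 1, 2]`. [OURS]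
[cite: Hartshorne1977, I Thm. 5.1, I Ex. 5.8] -/
theorem isoHypPoint_threeA2Cubic (K : Type) [Field K] [IsAlgClosed K] :
    letI := MvPolynomial.gradedAlgebra (σ := Fin (1 + 2 + 1)) (R := K)
    IsoHypPoint K 3 (hypersurface (form K)).left (hypersurfaceι (form K)).left := by
  letI := MvPolynomial.gradedAlgebra (σ := Fin (1 + 2 + 1)) (R := K)
  refine isoHypPoint_of_singularOneStepVertices K (form K) (isHomogeneous_form K) (prime_form K) [0, 1, 2]
    (fun c hc => ?_) (fun c hc P hP hf hd => ?_) (fun c hc => ?_)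
  · have hc3 : c ≠ 3 := by
      rintro rfl
      exact absurd hc (by decide)
    exact ⟨2, _, _, le_rfl, by simpa using (isHomogeneous_X K 0).mul (isHomogeneous_X K 1), quad_ne_zero K, cube_mem_pow K,
      dehomogenize_form_of_ne K c hc3, oneStep_data K⟩
  · have hc3 : c ≠ 3 := by
      rintro rfl
      exact absurd hc (by decide)
    rw [dehomogenize_form_of_ne K c hc3] at hf hd
    exact chartEqn_singular_only_origin K P hP hf hd
  · have hc3 : c = 3 := by
      fin_cases c
      · exact absurd (by decide) hc
      · exact absurd (by decide) hc
      · exact absurd (by decide) hc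
      · rfl
    subst hc3
    exact isRegularRing_chartRing_three K

end ThreeA2Cubic

end Summit.ResolutionOfSingularities.ResolutionOfSingularities.Cruxes.EquisingularLiftNat.Sections

end
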